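import Summits.ABC.ABC.Theses.IUTThetaPilot
import Literature.IUT.LogVolume.Corollary23JInv
import HarnessLib

set_option linter.dupNamespace false

/-!
# Route `route-ABC-IUTThetaPilot`, support item `JInvWlog` (stmt-ABC-19680) — CLOSED by the tree's proof

The route file `Summits/ABC/ABC/Theses/IUTThetaPilot.lean` (abc-iut-plan gen 5, 2026-08-25) carries the
support item

  `JInvWlog : Prop := Literature.IUT.LogVolume.Cor22.JInvVacuous`

— the WLOG step opening the proof of [IUTchIV] Corollary 2.2 (S. Mochizuki, *Inter-universal Teichmüller
theory IV*, kurims manuscript (Apr. 2020), §2, Cor. 2.2, proof, p. 41: one may assume the compactly bounded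
subset bounds the `j`-invariant at `2`), used by `Cor22.abcCompactlyBounded_two_of_corollary22` in the
route's deciding theorem `closes`. The statement `Cor22.JInvVacuous` (abc-iut-S3, `Corollary23Chain.lean`)
was PROVED in the tree by abc-iut-S-d3 as `Literature.IUT.LogVolume.Cor22.jInvVacuous_holds`
(`Corollary23JInv.lean`, p407661); at the time the route was born that file's olean was pending, so the
planner carried the statement by name as a support binder. This file discharges the binder: the item's
decl, literally, from the landed theorem. Nothing here bears on the crux `ThetaPartII` ([IUTchIV] Cor. 2.2
(ii) uniform) or takes a side on [IUTchIII] Cor. 3.12. [claim: Mochizuki2012, status: disputed] for the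
IUT sentence quoted; the mathematics used is abc-iut-S-d3's classical WLOG argument.
-/

namespace Summit.ABC.ABC.Theorems

/-- **stmt-ABC-19680 `JInvWlog`** (route-ABC-IUTThetaPilot, support): the WLOG step of [IUTchIV] Cor. 2.2 —
`Summit.ABC.ABC.Theses.IUTThetaPilot.JInvWlog` HOLDS, being by definition
`Literature.IUT.LogVolume.Cor22.JInvVacuous`, proved in the tree as `Cor22.jInvVacuous_holds`
(abc-iut-S-d3, p407661). [cite: Mochizuki2012, IUTchIV Cor. 2.2 p.41] -/
theorem JInvWlog_proof : Summit.ABC.ABC.Theses.IUTThetaPilot.JInvWlog := by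
  unfold Summit.ABC.ABC.Theses.IUTThetaPilot.JInvWlog
  exact Literature.IUT.LogVolume.Cor22.jInvVacuous_holds

end Summit.ABC.ABC.Theorems
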